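import Summits.QuantumFields.YangMills.Theorems.BalabanUVNodesN22AtRecordOfKernelFading

/-!
# BalabanUVNodes ∕ node N22 = NE9 — THE KERNEL-FADING ROAD RE-KEYED ON A TERM-LEVEL SECOND-DIFFERENCE LETTER, and its PRINT-FAITHFUL (possibility-1) producer:
# SECTOR holomorphy in a young coupling with QUADRATIC vanishing at zero coupling ⟹ uniform second differences — no disc through `g = 0`

Cell `pub-ymgap`, HUMAN RULING D-0062 (Track A), R134 seat `pub-ymgap-dag-n22-c` (strategy s1), generation 15, module J45.  THEOREMS ONLY (no `def`, no `sorry`, standard axioms);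
`--kind proof --supports stmt-QuantumFields-27366 --as helper` (K3⁸ `SpineGivenEndpointR13SepCoPHV`, skeleton v6), COUNT-NEUTRAL.  Imports module J40 `…N22AtRecordOfKernelFading` (and
through it J39 `…N22WindowedSecondDiffOutputLevel`, J38 `…N22KernelFadingOfStepRate`, `B12Ineq418Flat.norm_secondDiff_le`).  Nothing re-declared.

WHY (LOCATED, this lane's g6 honesty rider 26′ `…N22W1StripLastTermwiseVertexRider`, re-read at g15).  Modules J39–J44 feed the LAST young coupling into the kernel-fading road
through holomorphy on closed discs of ONE radius about every `t ∈ [0, γ]` (`hL` at `i = k`; node N09's `EHoloAt` families) — discs that contain ZERO coupling.  26′ located that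
clause as possibility-2-typed ([I] p. 266 «`g_k∕γ_k·ε₁` instead of `ε₁` … then `E^{(j)}`, `β_j` are analytic functions of the effective coupling constants») and, under the record's
possibility-1 χ-species (thresholds `ε₁∕‖g‖`), inhabited only coupling-blind (`thresholdLaw_frozen_of_lastDiscs`, `not_lastDiscs_invNorm`).  But the kernel-fading road
(dag-n22-a's discrete Landau–Kolmogorov knit at the kernels, J38) consumes ONLY SECOND DIFFERENCES in each young coupling with a UNIFORM constant.  THIS FILE therefore
(i) re-keys J39 §3 and J40 §1 on a TERM-LEVEL SECOND-DIFFERENCE LETTER — the road's honest interface, of which one-radius holomorphy (J39 §1), print's real `C²`∕`C^∞` clause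
([I] p. 263 «It is a C^∞-function of g_{j−1} ∈ [0, γ]»; p. 264 «uniformly bounded on this interval together with all derivatives») and SECTOR holomorphy are three producers —
and (ii) proves the SECTOR producer: holomorphy on the RELATIVE discs `closedBall s (c·s)`, `s ∈ ]0, γ]` (a sector at `0`, never containing `0`: the complexified Gaussian
`exp(−⟨B, ΔB⟩∕2g²)` of (2.12)–(2.13) p. 268 keeps a positive-definite real part for `|arg g| < π∕4`) together with the CENTRED QUADRATIC bound `‖E(z) − V‖ ≤ B·s²` there
((2.13) p. 268 «the expression under the exponential above vanishes at g_k = 0» + the `(g, B) ↦ (−g, −B)` parity of (2.12), the cell's g6 (S-vertex-T′) currency) gives second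
differences `≤ (6c² + 32c + 64)∕c² · B · d²` at EVERY step `t ± d ∈ ]0, γ]` (§1).  Under possibility 1 NO young coordinate has a uniform disc (a coordinate's chart is born at its
creation step on the sector and propagates through the generator), so the sector datum is stated for every `i ≤ k` (module J46, sequel).
* §1 ★ `norm_secondDiff_le_of_sectorHolo` — generic complex analysis (Cauchy at second order on the disc about `t − d` of radius `c(t − d)` when `d ≤ c(t−d)∕4`; the quadratic
  vanishing itself at the three real points otherwise, where `t < d(1 + 4∕c)`).
* §2 ★ `windowedSecondDiff_localizedSum_of_termSecondDiff` — J39 §3 with its margin datum `hL` REPLACED by the letter `hΔ`: `‖E(g∣g_i:=t+d) − 2E(g∣g_i:=t) + E(g∣g_i:=t−d)‖ ≤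
  M₂·e^{−κ_E d_{k+1}(X)}·d²` on the space tables, every torus ∕ level ∕ coordinate ∕ box history ∕ step ⟹ the windowed second-difference letter, eventually in `K`, with
  `C₂ = (16M₂B₃²∕r²)·e^{12Mδ₁}·K₀(64,8)·K₁(4,δ₀∕2)` (J39's proof verbatim around the new letter).
* §3 ★ `kernelSecondDiff_objectsOfRecord₁₃_of_termSecondDiff` — J40 §1 likewise: W1-20's law + (1.21) + term holomorphy through the readings + chart∕space clauses + tails ⟹ (R₂)
  at the kernel functional of record `(objectsOfRecord₁₃ F N θ ℓ).EA 0` with J38's shape.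

HONEST FRAMING (binding).  Count-neutral; §1 is elementary complex analysis, §2–§3 are J39∕J40's compositions re-keyed; NO estimate of Bałaban's is proved or asserted; the
term-level second-difference letter, the sector datum, the readings ∕ tails ∕ law ∕ (1.21) are HYPOTHESES with their owners (N09 ∕ N10 ∕ NODE A ∕ def-W1 ∕ dag-n22-w3's road);
nothing of the record is constructed or claimed to meet them; N22 is NOT discharged (typed 28∕28 · discharged 5∕27 UNCHANGED); K3⁸ OPEN and NOT claimed; NE9 is NOT IN PRINT
for d = 4; no count claim; one finite 𝕋⁴ programme at fixed ε — R4 closes the CONDITIONAL rung `BalabanLadder.UV` only; NOTHING about the continuum limit, ℝ⁴, infinite volume,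
OS axioms, a mass gap or the Clay problem is proved or claimed.  References (TYPES only, no cite tags on the Summit side): [I] = Bałaban, CMP 109 (1987) §1 p. 263 with (1.18),
(1.20)–(1.22) p. 264, (2.9) p. 266, (2.12)–(2.13) p. 268, p. 282 (site-weight tails: the sentence after (4.4)), (4.35)–(4.37) pp. 290–291, (5.10) p. 293; [II] = CMP 116 (1988)
(2.3) p. 12, (2.13)–(2.14) pp. 14–15.
-/

noncomputable section

open Filter Topology Set Metric
open scoped BigOperators

namespace YMDAG.N22.KernelFading

open Literature.MathematicalPhysics.QuantumFieldTheory.Balaban1983to89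
open Literature.MathematicalPhysics.QuantumFieldTheory.Balaban1983to89.T4Continuum (T4Family)
open Literature.MathematicalPhysics.QuantumFieldTheory.Balaban1983to89.T4OutputRate (Window)
open Literature.MathematicalPhysics.QuantumFieldTheory.Balaban1983to89.TreeLengthTorus (TPt torusTreeLen torusTreeLen_nonneg)
open Literature.MathematicalPhysics.QuantumFieldTheory.Balaban1983to89.B12TreeDecay (K₀ kappa₀ K₀_pos)
open Literature.MathematicalPhysics.QuantumFieldTheory.Balaban1983to89.B12PolarizationTensor120 (expChart expChart_apply)
open Literature.MathematicalPhysics.QuantumFieldTheory.Balaban1983to89.B12Decay510 (delta1)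
open Literature.MathematicalPhysics.QuantumFieldTheory.Balaban1983to89.B12Decay510Window (K₁ K₁_nonneg)
open Literature.MathematicalPhysics.QuantumFieldTheory.Balaban1983to89.B12Decay510Torus (distCT nearT)
open Literature.MathematicalPhysics.QuantumFieldTheory.Balaban1983to89.B12Sec2to5 (l1)
open Literature.MathematicalPhysics.QuantumFieldTheory.Balaban1983to89.B12Ineq418Flat (norm_secondDiff_le)
open Literature.MathematicalPhysics.QuantumFieldTheory.Balaban1983to89.Node00 (TermFamily1 polWindow siteOfInt mergedTermFamilyMatT TβOfRecord₁₃ chiβOfRecord₁₃ Stage13Params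
  U3Letters₁₁ MatA)
open Literature.MathematicalPhysics.QuantumFieldTheory.Balaban1983to89.Node00.Sect2 (domSys domCount CPair)
open Literature.MathematicalPhysics.QuantumFieldTheory.Balaban1983to89.Node00.W1
open Literature.MathematicalPhysics.QuantumFieldTheory.Balaban1983to89.Node00.LocalizedSum17 (localizedSum ReadingMaps Localizes17OfRecord₁₃)
open Literature.MathematicalPhysics.QuantumFieldTheory.Balaban1983to89.Node00.U3OfKernels (histPrefix kernelA EA objectsOfRecord₁₃ kernelA_eq)
open Literature.MathematicalPhysics.QuantumFieldTheory.Balaban1983to89.Node00.U3KernelLetters (PolLimitsExistOfRecord₁₃ polLimitsExistOfRecord₁₃_iff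
  polWindow_eventuallyEq_of_eventuallyAgree)
open YMDAG.N22.WindowSoftTwoPoint (eventually_le_of_softSum_domSys)
open YMDAG.N22.OutputLevel (outputValueSummand_le_softMajorant)
open YMDAG.N22.WindowedSecondDiff (abs_secondDiff_polWindow_localizedSum_le_soft histPrefix_update)

open scoped Matrix.Norms.L2Operator

/-! ## §1 Complex analysis: SECTOR holomorphy with quadratic vanishing at zero coupling ⟹ uniform second differences on `]0, γ]` -/

/-- ★ **SECOND DIFFERENCES FROM SECTOR HOLOMORPHY WITH A CENTRED QUADRATIC BOUND (Cauchy at second order on RELATIVE discs).**  If `Ec` is holomorphic on a set `O`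
containing the closed discs `closedBall s (c·s)` about every `s ∈ ]0, γ]` (`c > 0`; none of them contains `0`) and `‖Ec z − V‖ ≤ B·s²` on those discs for a fixed value `V`, then
for `t ± d ∈ ]0, γ]`, `d > 0`: `‖Ec(t+d) − 2Ec(t) + Ec(t−d)‖ ≤ (6c² + 32c + 64)∕c² · B · d²` — for `d ≤ c(t−d)∕4` by `B12Ineq418Flat.norm_secondDiff_le` on the open disc about `t − d`
of radius `c(t − d)` applied to `Ec − V` (bound `B(t−d)²`, margin `c(t−d)∕4`: `16B∕c²·d²`), otherwise `t < d(1 + 4∕c)` and the three quadratic bounds at the real points give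
`B(4t² + 2d²) ≤ (6c² + 32c + 64)∕c²·B·d²`. [folklore] -/
theorem norm_secondDiff_le_of_sectorHolo {Ec : ℂ → ℂ} {O : Set ℂ} {γ c B : ℝ} {V : ℂ} (hc : 0 < c) (hB : 0 ≤ B)
    (hhol : DifferentiableOn ℂ Ec O) (hball : ∀ s ∈ Ioc (0 : ℝ) γ, closedBall (s : ℂ) (c * s) ⊆ O)
    (hbd : ∀ s ∈ Ioc (0 : ℝ) γ, ∀ z ∈ closedBall (s : ℂ) (c * s), ‖Ec z - V‖ ≤ B * s ^ 2)
    {t d : ℝ} (hd : 0 < d) (hm : t - d ∈ Ioc (0 : ℝ) γ) (hp : t + d ∈ Ioc (0 : ℝ) γ) :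
    ‖Ec ((t + d : ℝ) : ℂ) - 2 * Ec (t : ℂ) + Ec ((t - d : ℝ) : ℂ)‖ ≤ (6 * c ^ 2 + 32 * c + 64) / c ^ 2 * B * d ^ 2 := by
  have ht : t ∈ Ioc (0 : ℝ) γ := ⟨by linarith [hm.1], by linarith [hp.2]⟩
  -- pass to `Fv := Ec − V` (second differences kill the constant)
  set Fv : ℂ → ℂ := fun z => Ec z - V with hFv
  have eΔ : Ec ((t + d : ℝ) : ℂ) - 2 * Ec (t : ℂ) + Ec ((t - d : ℝ) : ℂ) =
      Fv ((t + d : ℝ) : ℂ) - 2 * Fv (t : ℂ) + Fv ((t - d : ℝ) : ℂ) := by simp only [hFv]; ring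
  rw [eΔ]
  have hholF : DifferentiableOn ℂ Fv O := hhol.sub_const V
  have hbdF : ∀ s ∈ Ioc (0 : ℝ) γ, ∀ z ∈ closedBall (s : ℂ) (c * s), ‖Fv z‖ ≤ B * s ^ 2 := fun s hs z hz => hbd s hs z hz
  have hc2 : 0 < c ^ 2 := by positivity
  -- the target constant dominates both branches
  by_cases hdc : d ≤ c * (t - d) / 4
  · -- small step: Cauchy at second order on the disc about `t − d` of radius `c (t − d)`
    set p : ℂ := ((t - d : ℝ) : ℂ) with hp_def
    set ρ : ℝ := c * (t - d) with hρ_def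
    have hρ : 0 < ρ := mul_pos hc hm.1
    have hsub : ball p ρ ⊆ O := ball_subset_closedBall.trans (hball _ hm)
    have hholU : DifferentiableOn ℂ Fv (ball p ρ) := hholF.mono hsub
    have hnd : ‖(d : ℂ)‖ = d := by rw [Complex.norm_real, Real.norm_eq_abs, abs_of_pos hd]
    have hmem : ∀ s s' : ℂ, ‖s‖ * ‖(d : ℂ)‖ < ‖(d : ℂ)‖ + ρ / 4 → ‖s'‖ * ‖(d : ℂ)‖ < ‖(d : ℂ)‖ + ρ / 4 →
        p + s • (d : ℂ) + s' • (d : ℂ) ∈ ball p ρ := by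
      intro s s' hs hs'
      rw [hnd] at hs hs'
      rw [mem_ball, dist_eq_norm, show p + s • (d : ℂ) + s' • (d : ℂ) - p = s • (d : ℂ) + s' • (d : ℂ) by ring]
      calc ‖s • (d : ℂ) + s' • (d : ℂ)‖ ≤ ‖s • (d : ℂ)‖ + ‖s' • (d : ℂ)‖ := norm_add_le _ _
        _ = ‖s‖ * d + ‖s'‖ * d := by rw [norm_smul, norm_smul, hnd]
        _ < (d + ρ / 4) + (d + ρ / 4) := add_lt_add hs hs'
        _ ≤ ρ := by linarith
    have hM0 : 0 ≤ B * (t - d) ^ 2 := by positivity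
    have hbdU : ∀ q ∈ ball p ρ, ‖Fv q‖ ≤ B * (t - d) ^ 2 := fun q hq => hbdF _ hm q (ball_subset_closedBall hq)
    have h := norm_secondDiff_le (f := Fv) isOpen_ball hholU hM0 (by positivity : (0 : ℝ) < ρ / 4) p (d : ℂ) (d : ℂ) hmem hbdU
    have e1 : p + (d : ℂ) + (d : ℂ) = ((t + d : ℝ) : ℂ) := by rw [hp_def]; push_cast; ring
    have e2 : p + (d : ℂ) = (t : ℂ) := by rw [hp_def]; push_cast; ring
    rw [e1, e2, show Fv ((t + d : ℝ) : ℂ) - Fv (t : ℂ) - Fv (t : ℂ) + Fv p = Fv ((t + d : ℝ) : ℂ) - 2 * Fv (t : ℂ) + Fv ((t - d : ℝ) : ℂ) by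
      rw [hp_def]; ring, hnd] at h
    have htd : 0 < t - d := hm.1
    calc ‖Fv ((t + d : ℝ) : ℂ) - 2 * Fv (t : ℂ) + Fv ((t - d : ℝ) : ℂ)‖ ≤ B * (t - d) ^ 2 * d * d / (ρ / 4) ^ 2 := h
      _ = 16 * B / c ^ 2 * d ^ 2 := by rw [hρ_def]; field_simp; ring
      _ ≤ (6 * c ^ 2 + 32 * c + 64) / c ^ 2 * B * d ^ 2 := by
          have h16 : (16 : ℝ) ≤ 6 * c ^ 2 + 32 * c + 64 := by nlinarith [sq_nonneg c, hc.le]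
          have hBd : 0 ≤ B * d ^ 2 := by positivity
          have h16' : 16 / c ^ 2 ≤ (6 * c ^ 2 + 32 * c + 64) / c ^ 2 := div_le_div_of_nonneg_right h16 hc2.le
          calc 16 * B / c ^ 2 * d ^ 2 = 16 / c ^ 2 * (B * d ^ 2) := by ring
            _ ≤ (6 * c ^ 2 + 32 * c + 64) / c ^ 2 * (B * d ^ 2) := mul_le_mul_of_nonneg_right h16' hBd
            _ = (6 * c ^ 2 + 32 * c + 64) / c ^ 2 * B * d ^ 2 := by ring
  · -- large step: `c (t − d) < 4 d`, so `c t < c d + 4 d`; the three quadratic bounds at the real points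
    have hlt : c * (t - d) < 4 * d := by
      have := lt_of_not_ge hdc
      linarith
    have hct : c * t < c * d + 4 * d := by nlinarith
    have mem_self : ∀ s ∈ Ioc (0 : ℝ) γ, ((s : ℝ) : ℂ) ∈ closedBall (s : ℂ) (c * s) := fun s hs =>
      mem_closedBall_self (mul_pos hc hs.1).le
    have h1 : ‖Fv ((t + d : ℝ) : ℂ)‖ ≤ B * (t + d) ^ 2 := hbdF _ hp _ (mem_self _ hp)
    have h2 : ‖Fv (t : ℂ)‖ ≤ B * t ^ 2 := hbdF _ ht _ (mem_self _ ht)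
    have h3 : ‖Fv ((t - d : ℝ) : ℂ)‖ ≤ B * (t - d) ^ 2 := hbdF _ hm _ (mem_self _ hm)
    have h4 : ‖Fv ((t + d : ℝ) : ℂ) - 2 * Fv (t : ℂ) + Fv ((t - d : ℝ) : ℂ)‖ ≤ B * (4 * t ^ 2 + 2 * d ^ 2) := by
      calc ‖Fv ((t + d : ℝ) : ℂ) - 2 * Fv (t : ℂ) + Fv ((t - d : ℝ) : ℂ)‖
          ≤ ‖Fv ((t + d : ℝ) : ℂ) - 2 * Fv (t : ℂ)‖ + ‖Fv ((t - d : ℝ) : ℂ)‖ := norm_add_le _ _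
        _ ≤ (‖Fv ((t + d : ℝ) : ℂ)‖ + ‖2 * Fv (t : ℂ)‖) + ‖Fv ((t - d : ℝ) : ℂ)‖ := by gcongr; exact norm_sub_le _ _
        _ ≤ (B * (t + d) ^ 2 + 2 * (B * t ^ 2)) + B * (t - d) ^ 2 := by
            gcongr
            rw [norm_mul, Complex.norm_ofNat]; linarith
        _ = B * (4 * t ^ 2 + 2 * d ^ 2) := by ring
    have h5 : B * (4 * t ^ 2 + 2 * d ^ 2) ≤ (6 * c ^ 2 + 32 * c + 64) / c ^ 2 * B * d ^ 2 := by
      rw [div_mul_eq_mul_div, div_mul_eq_mul_div, le_div_iff₀ hc2]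
      -- `c² · B(4t² + 2d²) ≤ (6c² + 32c + 64) B d²` from `(ct)² ≤ (cd + 4d)²`
      have hct' : (c * t) ^ 2 ≤ (c * d + 4 * d) ^ 2 := by
        have h0 : 0 ≤ c * t := by have := ht.1; positivity
        nlinarith
      have hBt : B * ((c * t) ^ 2) ≤ B * ((c * d + 4 * d) ^ 2) := mul_le_mul_of_nonneg_left hct' hB
      nlinarith [hBt, hB, sq_nonneg d, sq_nonneg c]
    exact h4.trans h5

/-! ## §2 The windowed second-difference letter from a TERM-LEVEL second-difference letter (J39 §3 re-keyed) -/

section Letter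

variable (F : T4Family) {𝔄 : Type*} [NormedRing 𝔄] [NormedAlgebra ℝ 𝔄] {V : Type*} [NormedAddCommGroup V] [NormedSpace ℝ V]
  {ι' : Type*} [Fintype ι'] {𝔸 : Type*} {M : ℕ}

open Classical in
/-- ★ **THE WINDOWED SECOND-DIFFERENCE LETTER FROM A TERM-LEVEL SECOND-DIFFERENCE LETTER.**  For node00-def-W1's towers `S K` read through `emb` and a chart `(ρ, bV)`: IF for every
torus `K`, level `k`, young coordinate `i ≤ k`, box prefix `g`, domain `X` and admissible configuration `φ ∈ sp K k X` the (2.13) term has second differences in `g_i`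
`‖E(X; g∣g_i := t+d; φ) − 2E(X; g∣g_i := t; φ) + E(X; g∣g_i := t−d; φ)‖ ≤ M₂·e^{−κ_E d_{k+1}(X)}·d²` for all `t ± d ∈ ]0, γ]` (`M₂ ≥ 0`, `κ ≤ κ_E`; ANY producer: J39 §1's one
radius, §1's sector, print's `C²` clause), AND the term is holomorphic through complexified probe readings `Φ K k X` (open `U ⊇ ball 0 r`, chart clause, space clause) at every
window history, with site weights `w ≤ B₃e^{−δ₀·dist}` (tails) and `2κ₀(64,8) ≤ κ`, THEN for every window history, level, coordinate and step the second difference of the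
WINDOWED kernels is eventually (in `K`) `≤ (16M₂B₃²∕r²)·e^{12Mδ₁}·K₀(64,8)·K₁(4,δ₀∕2)·d²·e^{−δ₁|z|₁}`, `δ₁ = delta1 δ₀ κ (4M)` — J39 §2 at the per-term bound `M₂e^{−κ_E d}d²`,
soft majorants (J36), the soft window machinery.  J39 §3's proof with `hL`∕§1 replaced by the letter. [folklore] -/
theorem windowedSecondDiff_localizedSum_of_termSecondDiff (m' : ℕ) (M : ℕ) [NeZero M] (hM : M = F.L ^ m')
    (S : (K : ℕ) → ClusterTower (F.P K) 𝔸 M) (emb : ReadingMaps F 𝔄 𝔸) (ρ : V →L[ℝ] 𝔄) (bV : Module.Basis ι' ℝ V)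
    {γ : ℝ} (sp : (K k : ℕ) → (domSys (F.P K) M (k + 1)).Dom → Set (CPair (F.P K) 𝔸))
    {κ κE δ₀ B₃ r M₂ : ℝ}
    (hκ₀ : kappa₀ (4 * 2 ^ 4) (2 * 4) ≤ κ / 2) (hδ₀ : 0 < δ₀) (hB₃ : 0 ≤ B₃) (hr : 0 < r) (hM₂ : 0 ≤ M₂) (hκE : κ ≤ κE)
    (hΔ : ∀ (K k : ℕ) (i : Fin (k + 1)), ∀ g ∈ box γ k, ∀ (X : (domSys (F.P K) M (k + 1)).Dom), ∀ φ ∈ sp K k X, ∀ t d : ℝ, 0 < d →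
      t - d ∈ Ioc (0 : ℝ) γ → t + d ∈ Ioc (0 : ℝ) γ →
        ‖((S K) k).E (Function.update g i (t + d)) φ X - 2 * ((S K) k).E (Function.update g i t) φ X + ((S K) k).E (Function.update g i (t - d)) φ X‖ ≤
          M₂ * Real.exp (-(κE * (domSys (F.P K) M (k + 1)).dj X)) * d ^ 2)
    (Ec : ℕ → ℕ → Type*) [∀ K k, NormedAddCommGroup (Ec K k)] [∀ K k, NormedSpace ℂ (Ec K k)]
    (ι : (K k : ℕ) → (domSys (F.P K) M (k + 1)).Dom → ((Fin (F.P K).d → Site (F.P K) (k + 1) → V) →L[ℝ] Ec K k))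
    (Φ : (K k : ℕ) → (domSys (F.P K) M (k + 1)).Dom → Ec K k → CPair (F.P K) 𝔸)
    (U : (K k : ℕ) → (domSys (F.P K) M (k + 1)).Dom → Set (Ec K k)) (hU : ∀ K k X, IsOpen (U K k X)) (hrU : ∀ K k X, ball (0 : Ec K k) r ⊆ U K k X)
    (hEhol : ∀ g ∈ Window γ, ∀ (K k : ℕ) (X : (domSys (F.P K) M (k + 1)).Dom),
      DifferentiableOn ℂ (fun z => ((S K) k).E (histPrefix g k) (Φ K k X z) X) (U K k X))
    (hΦemb : ∀ (K k : ℕ) (X : (domSys (F.P K) M (k + 1)).Dom) (Bf : Fin (F.P K).d → Site (F.P K) (k + 1) → V),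
      Φ K k X (ι K k X Bf) = emb K k (fun l t => NormedSpace.exp (ρ (Bf l t))))
    (hΦsp : ∀ (K k : ℕ) (X : (domSys (F.P K) M (k + 1)).Dom), ∀ z ∈ ball (0 : Ec K k) r, Φ K k X z ∈ sp K k X)
    (w : (K k : ℕ) → (domSys (F.P K) M (k + 1)).Dom → Site (F.P K) (k + 1) → ℝ) (hw₀ : ∀ K k X t, 0 ≤ w K k X t)
    (hw : ∀ (K k : ℕ) (X : (domSys (F.P K) M (k + 1)).Dom) (l : Fin (F.P K).d) (t : Site (F.P K) (k + 1)) (c : ι'),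
      ‖ι K k X (Pi.single l (Pi.single t (bV c)))‖ ≤ w K k X t)
    (htail : ∀ (K k : ℕ) (X : (domSys (F.P K) M (k + 1)).Dom) (t : Site (F.P K) (k + 1)),
      let e : Site (F.P K) (k + 1) → TPt 4 (domCount (F.P K) M (k + 1) * M) := fun x i => (ZMod.cast (x i) : ZMod (domCount (F.P K) M (k + 1) * M))
      w K k X t ≤ B₃ * Real.exp (-δ₀ * distCT (domCount (F.P K) M (k + 1)) M (e t) (nearT (M := M) (e t) X))) :
    ∀ g ∈ Window γ, ∀ (k : ℕ) (μ ν : Fin 4) (z : Fin 4 → ℤ) (i : ℕ), i < k + 1 → ∀ t d : ℝ, 0 < d →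
      t - d ∈ Ioc (0 : ℝ) γ → t + d ∈ Ioc (0 : ℝ) γ → ∀ᶠ K in atTop,
        |polWindow F K (k + 1) (localizedSum F S emb k (histPrefix (Function.update g i (t + d)) k) K) ρ bV μ ν z -
            2 * polWindow F K (k + 1) (localizedSum F S emb k (histPrefix (Function.update g i t) k) K) ρ bV μ ν z +
            polWindow F K (k + 1) (localizedSum F S emb k (histPrefix (Function.update g i (t - d)) k) K) ρ bV μ ν z| ≤
          (16 * M₂ * B₃ ^ 2 / r ^ 2) * Real.exp (delta1 δ₀ κ ((M : ℝ) * 4) * ((M : ℝ) * 4) * 3) * K₀ (4 * 2 ^ 4) (2 * 4) *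
            K₁ 4 (δ₀ / 2) * d ^ 2 * Real.exp (-(delta1 δ₀ κ ((M : ℝ) * 4) * l1 z)) := by
  intro g hg k μ ν z i hi t d hd hmI hpI
  have htI : t ∈ Ioc (0 : ℝ) γ := ⟨by linarith [hmI.1], by linarith [hpI.2]⟩
  -- the three updated histories are window histories; their prefixes are updates of the prefix of `g`
  have hgp : Function.update g i (t + d) ∈ Window γ := update_mem_window hg i hpI
  have hg0 : Function.update g i t ∈ Window γ := update_mem_window hg i htI
  have hgm : Function.update g i (t - d) ∈ Window γ := update_mem_window hg i hmI
  have hbox : histPrefix g k ∈ box γ k := YMDAG.N22.WindowedOfCouplingHolo.histPrefix_mem_box hg k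
  set iF : Fin (k + 1) := ⟨i, hi⟩ with hiF
  have ep : histPrefix (Function.update g i (t + d)) k = Function.update (histPrefix g k) iF (t + d) := histPrefix_update g k hi _
  have e0 : histPrefix (Function.update g i t) k = Function.update (histPrefix g k) iF t := histPrefix_update g k hi _
  have em : histPrefix (Function.update g i (t - d)) k = Function.update (histPrefix g k) iF (t - d) := histPrefix_update g k hi _
  -- the per-term second-difference bound on the complexified probe ball (the letter at `φ := Φ K k X z ∈ sp`)
  have hMx : ∀ (K : ℕ) (X : (domSys (F.P K) M (k + 1)).Dom), ∀ zz ∈ ball (0 : Ec K k) r,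
      ‖((S K) k).E (histPrefix (Function.update g i (t + d)) k) (Φ K k X zz) X - 2 * ((S K) k).E (histPrefix (Function.update g i t) k) (Φ K k X zz) X +
          ((S K) k).E (histPrefix (Function.update g i (t - d)) k) (Φ K k X zz) X‖ ≤
        M₂ * Real.exp (-(κE * (domSys (F.P K) M (k + 1)).dj X)) * d ^ 2 := by
    intro K X zz hzz
    rw [ep, e0, em]
    exact hΔ K k iF (histPrefix g k) hbox X (Φ K k X zz) (hΦsp K k X zz hzz) t d hd hmI hpI
  have hD : ∀ K : ℕ,
      |polWindow F K (k + 1) (localizedSum F S emb k (histPrefix (Function.update g i (t + d)) k) K) ρ bV μ ν z -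
          2 * polWindow F K (k + 1) (localizedSum F S emb k (histPrefix (Function.update g i t) k) K) ρ bV μ ν z +
          polWindow F K (k + 1) (localizedSum F S emb k (histPrefix (Function.update g i (t - d)) k) K) ρ bV μ ν z| ≤
        ∑ X : (domSys (F.P K) M (k + 1)).Dom, 16 * (M₂ * Real.exp (-(κE * torusTreeLen X.1)) * d ^ 2) / r ^ 2 *
          (w K k X (siteOfInt F K (k + 1) z) * w K k X (siteOfInt F K (k + 1) 0)) := fun K =>
    abs_secondDiff_polWindow_localizedSum_le_soft F S emb ρ bV k K _ _ _ (ι K k)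
      (fun X zz => ((S K) k).E (histPrefix (Function.update g i (t + d)) k) (Φ K k X zz) X)
      (fun X zz => ((S K) k).E (histPrefix (Function.update g i t) k) (Φ K k X zz) X)
      (fun X zz => ((S K) k).E (histPrefix (Function.update g i (t - d)) k) (Φ K k X zz) X)
      (U K k) (hU K k) (fun X => hEhol _ hgp K k X) (fun X => hEhol _ hg0 K k X) (fun X => hEhol _ hgm K k X) hr (hrU K k)
      (fun X Bf => by rw [expChart_apply, hΦemb]) (fun X Bf => by rw [expChart_apply, hΦemb]) (fun X Bf => by rw [expChart_apply, hΦemb])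
      (fun X => M₂ * Real.exp (-(κE * torusTreeLen X.1)) * d ^ 2) (fun X zz hzz => hMx K X zz hzz) (w K k) (hw₀ K k) (hw K k) μ ν z
  -- soft majorants with the uniform letter `M₂·d²` in the place of `B`
  have hB' : 0 ≤ M₂ * d ^ 2 := by positivity
  have hCE : (0 : ℝ) ≤ 16 * (M₂ * d ^ 2) * B₃ ^ 2 / r ^ 2 := by positivity
  have h := eventually_le_of_softSum_domSys F (k + 1) m' M hM
    (fun K => |polWindow F K (k + 1) (localizedSum F S emb k (histPrefix (Function.update g i (t + d)) k) K) ρ bV μ ν z -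
        2 * polWindow F K (k + 1) (localizedSum F S emb k (histPrefix (Function.update g i t) k) K) ρ bV μ ν z +
        polWindow F K (k + 1) (localizedSum F S emb k (histPrefix (Function.update g i (t - d)) k) K) ρ bV μ ν z|)
    (fun K X => 16 * (M₂ * Real.exp (-(κE * torusTreeLen X.1)) * d ^ 2) / r ^ 2 *
      (w K k X (siteOfInt F K (k + 1) z) * w K k X (siteOfInt F K (k + 1) 0)))
    hCE zero_le_one hδ₀ hκ₀ z hD (fun K X => ?_)
  · filter_upwards [h] with K hK
    refine hK.trans (le_of_eq ?_)
    ring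
  · have e : 16 * (M₂ * Real.exp (-(κE * torusTreeLen X.1)) * d ^ 2) / r ^ 2 *
        (w K k X (siteOfInt F K (k + 1) z) * w K k X (siteOfInt F K (k + 1) 0)) =
        16 * ((M₂ * d ^ 2) * Real.exp (-(κE * torusTreeLen X.1))) / r ^ 2 *
          (w K k X (siteOfInt F K (k + 1) z) * w K k X (siteOfInt F K (k + 1) 0)) := by ring
    rw [e]
    exact outputValueSummand_le_softMajorant hB' hr hB₃ (hw₀ K k X _) (Real.exp_nonneg _) (Real.exp_nonneg _) (htail K k X _) (htail K k X _) hκE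
      (torusTreeLen_nonneg _)

end Letter

/-! ## §3 (R₂) at the kernel functional of record from the term-level letter (J40 §1 re-keyed) -/

section Record

variable (F : T4Family) (N : ℕ) [NeZero N] {𝔸 : Type*} {M : ℕ}

open Classical in
/-- ★ **(R₂) AT THE KERNEL FUNCTIONAL OF RECORD FROM A TERM-LEVEL SECOND-DIFFERENCE LETTER.**  Towers `S K` read through `emb : ReadingMaps F (MatA N) 𝔸` with W1-20's law
`Localizes17OfRecord₁₃ F N θ S emb`; §2's inputs at the chart of record `θ.ρ8 ∕ θ.bV` (the letter `hΔ` with constant `M₂`, term holomorphy through the readings for every window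
history, chart∕space clauses, site-weight tails; `M = L^{m′}`); `PolLimitsExistOfRecord₁₃ F N θ` ⟹ the second differences of the limiting kernels of record in every young coupling
on `]0, θ.γ]` are `≤ C₂·e^{−δ₁|z|₁}·d²`, `C₂ = (16M₂B₃²∕r²)·e^{12Mδ₁}·K₀·K₁` — §2 + `polWindow_eventuallyEq_of_eventuallyAgree` (three histories) + J38's `abs_secondDiff_le_of_tendsto`.
J40 §1's proof with `hL` replaced by the letter. [folklore] -/
theorem kernelSecondDiff_objectsOfRecord₁₃_of_termSecondDiff (θ : Stage13Params F N) (ℓ : U3Letters₁₁) (hlim : PolLimitsExistOfRecord₁₃ F N θ)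
    (m' : ℕ) (M : ℕ) [NeZero M] (hM : M = F.L ^ m')
    (S : (K : ℕ) → ClusterTower (F.P K) 𝔸 M) (emb : ReadingMaps F (MatA N) 𝔸) (hloc : Localizes17OfRecord₁₃ F N θ S emb)
    (sp : (K k : ℕ) → (domSys (F.P K) M (k + 1)).Dom → Set (CPair (F.P K) 𝔸))
    {κ κE δ₀ B₃ r M₂ : ℝ}
    (hκ₀ : kappa₀ (4 * 2 ^ 4) (2 * 4) ≤ κ / 2) (hδ₀ : 0 < δ₀) (hB₃ : 0 ≤ B₃) (hr : 0 < r) (hM₂ : 0 ≤ M₂) (hκE : κ ≤ κE)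
    (hΔ : ∀ (K k : ℕ) (i : Fin (k + 1)), ∀ g ∈ box θ.γ k, ∀ (X : (domSys (F.P K) M (k + 1)).Dom), ∀ φ ∈ sp K k X, ∀ t d : ℝ, 0 < d →
      t - d ∈ Ioc (0 : ℝ) θ.γ → t + d ∈ Ioc (0 : ℝ) θ.γ →
        ‖((S K) k).E (Function.update g i (t + d)) φ X - 2 * ((S K) k).E (Function.update g i t) φ X + ((S K) k).E (Function.update g i (t - d)) φ X‖ ≤
          M₂ * Real.exp (-(κE * (domSys (F.P K) M (k + 1)).dj X)) * d ^ 2)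
    (Ec : ℕ → ℕ → Type*) [∀ K k, NormedAddCommGroup (Ec K k)] [∀ K k, NormedSpace ℂ (Ec K k)]
    (ι : letI := θ.instVβ₁; letI := θ.instVβ₂
      (K k : ℕ) → (domSys (F.P K) M (k + 1)).Dom → ((Fin (F.P K).d → Site (F.P K) (k + 1) → θ.Vβ) →L[ℝ] Ec K k))
    (Φ : (K k : ℕ) → (domSys (F.P K) M (k + 1)).Dom → Ec K k → CPair (F.P K) 𝔸)
    (U : (K k : ℕ) → (domSys (F.P K) M (k + 1)).Dom → Set (Ec K k)) (hU : ∀ K k X, IsOpen (U K k X)) (hrU : ∀ K k X, ball (0 : Ec K k) r ⊆ U K k X)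
    (hEhol : ∀ g ∈ Window θ.γ, ∀ (K k : ℕ) (X : (domSys (F.P K) M (k + 1)).Dom),
      DifferentiableOn ℂ (fun z => ((S K) k).E (histPrefix g k) (Φ K k X z) X) (U K k X))
    (hΦemb : letI := θ.instVβ₁; letI := θ.instVβ₂
      ∀ (K k : ℕ) (X : (domSys (F.P K) M (k + 1)).Dom) (Bf : Fin (F.P K).d → Site (F.P K) (k + 1) → θ.Vβ),
        Φ K k X (ι K k X Bf) = emb K k (fun l t => NormedSpace.exp (θ.ρ8 (Bf l t))))
    (hΦsp : ∀ (K k : ℕ) (X : (domSys (F.P K) M (k + 1)).Dom), ∀ z ∈ ball (0 : Ec K k) r, Φ K k X z ∈ sp K k X)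
    (w : (K k : ℕ) → (domSys (F.P K) M (k + 1)).Dom → Site (F.P K) (k + 1) → ℝ) (hw₀ : ∀ K k X t, 0 ≤ w K k X t)
    (hw : letI := θ.instVβ₁; letI := θ.instVβ₂; letI := θ.instιβ
      ∀ (K k : ℕ) (X : (domSys (F.P K) M (k + 1)).Dom) (l : Fin (F.P K).d) (t : Site (F.P K) (k + 1)) (c : θ.ιβ),
        ‖ι K k X (Pi.single l (Pi.single t (θ.bV c)))‖ ≤ w K k X t)
    (htail : ∀ (K k : ℕ) (X : (domSys (F.P K) M (k + 1)).Dom) (t : Site (F.P K) (k + 1)),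
      let e : Site (F.P K) (k + 1) → TPt 4 (domCount (F.P K) M (k + 1) * M) := fun x i => (ZMod.cast (x i) : ZMod (domCount (F.P K) M (k + 1) * M))
      w K k X t ≤ B₃ * Real.exp (-δ₀ * distCT (domCount (F.P K) M (k + 1)) M (e t) (nearT (M := M) (e t) X))) :
    ∀ g ∈ Window θ.γ, ∀ (Uu : PUnit) (X : ((objectsOfRecord₁₃ F N θ ℓ).levelCarriers 0).Dom) (i : ℕ),
      i < ((objectsOfRecord₁₃ F N θ ℓ).levelCarriers 0).scale X → ∀ t d : ℝ, 0 < d → t - d ∈ Ioc (0 : ℝ) θ.γ → t + d ∈ Ioc (0 : ℝ) θ.γ →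
        |(objectsOfRecord₁₃ F N θ ℓ).EA 0 (Function.update g i (t + d)) Uu X - 2 * (objectsOfRecord₁₃ F N θ ℓ).EA 0 (Function.update g i t) Uu X +
            (objectsOfRecord₁₃ F N θ ℓ).EA 0 (Function.update g i (t - d)) Uu X| ≤
          (16 * M₂ * B₃ ^ 2 / r ^ 2) * Real.exp (delta1 δ₀ κ ((M : ℝ) * 4) * ((M : ℝ) * 4) * 3) * K₀ (4 * 2 ^ 4) (2 * 4) * K₁ 4 (δ₀ / 2) *
            Real.exp (-(delta1 δ₀ κ ((M : ℝ) * 4) * ((objectsOfRecord₁₃ F N θ ℓ).levelCarriers 0).d X)) * d ^ 2 := by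
  letI := θ.instVβ₁; letI := θ.instVβ₂; letI := θ.instιβ
  intro g hg Uu X i hi t d hd hm hp
  obtain ⟨k, μ, ν, z⟩ := X
  -- §2 at the reading of record
  have hW := windowedSecondDiff_localizedSum_of_termSecondDiff F m' M hM S emb θ.ρ8 θ.bV sp hκ₀ hδ₀ hB₃ hr hM₂ hκE hΔ Ec ι Φ U hU hrU hEhol hΦemb hΦsp
    w hw₀ hw htail g hg k μ ν z i hi t d hd hm hp
  -- transfer to the merged term family of record by W1-20's law, at the three updated histories
  have hA := hloc.eventuallyAgree F
  have ep := polWindow_eventuallyEq_of_eventuallyAgree F θ.ρ8 θ.bV hA (Function.update g i (t + d)) k μ ν z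
  have e0 := polWindow_eventuallyEq_of_eventuallyAgree F θ.ρ8 θ.bV hA (Function.update g i t) k μ ν z
  have em := polWindow_eventuallyEq_of_eventuallyAgree F θ.ρ8 θ.bV hA (Function.update g i (t - d)) k μ ν z
  have hW' : ∀ᶠ K in atTop,
      |polWindow F K (k + 1) (mergedTermFamilyMatT F N (TβOfRecord₁₃ F N) (chiβOfRecord₁₃ F N θ) θ.εbg k (histPrefix (Function.update g i (t + d)) k) K) θ.ρ8 θ.bV μ ν z -
          2 * polWindow F K (k + 1) (mergedTermFamilyMatT F N (TβOfRecord₁₃ F N) (chiβOfRecord₁₃ F N θ) θ.εbg k (histPrefix (Function.update g i t) k) K) θ.ρ8 θ.bV μ ν z +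
          polWindow F K (k + 1) (mergedTermFamilyMatT F N (TβOfRecord₁₃ F N) (chiβOfRecord₁₃ F N θ) θ.εbg k (histPrefix (Function.update g i (t - d)) k) K) θ.ρ8 θ.bV μ ν z| ≤
        (16 * M₂ * B₃ ^ 2 / r ^ 2) * Real.exp (delta1 δ₀ κ ((M : ℝ) * 4) * ((M : ℝ) * 4) * 3) * K₀ (4 * 2 ^ 4) (2 * 4) * K₁ 4 (δ₀ / 2) * d ^ 2 *
          Real.exp (-(delta1 δ₀ κ ((M : ℝ) * 4) * l1 z)) := by
    filter_upwards [hW, ep, e0, em] with K hK hKp hK0 hKm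
    rw [hKp, hK0, hKm]; exact hK
  -- (1.21) passage at the three histories
  have ht : t ∈ Ioc (0 : ℝ) θ.γ := ⟨by linarith [hm.1], by linarith [hp.2]⟩
  have hl := (polLimitsExistOfRecord₁₃_iff F N θ).1 hlim
  show |kernelA F (mergedTermFamilyMatT F N (TβOfRecord₁₃ F N) (chiβOfRecord₁₃ F N θ) θ.εbg) θ.ρ8 θ.bV (Function.update g i (t + d)) k μ ν z -
      2 * kernelA F (mergedTermFamilyMatT F N (TβOfRecord₁₃ F N) (chiβOfRecord₁₃ F N θ) θ.εbg) θ.ρ8 θ.bV (Function.update g i t) k μ ν z +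
      kernelA F (mergedTermFamilyMatT F N (TβOfRecord₁₃ F N) (chiβOfRecord₁₃ F N θ) θ.εbg) θ.ρ8 θ.bV (Function.update g i (t - d)) k μ ν z| ≤
    (16 * M₂ * B₃ ^ 2 / r ^ 2) * Real.exp (delta1 δ₀ κ ((M : ℝ) * 4) * ((M : ℝ) * 4) * 3) * K₀ (4 * 2 ^ 4) (2 * 4) * K₁ 4 (δ₀ / 2) *
      Real.exp (-(delta1 δ₀ κ ((M : ℝ) * 4) * l1 z)) * d ^ 2
  rw [kernelA_eq, kernelA_eq, kernelA_eq]
  refine (abs_secondDiff_le_of_tendsto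
    (Node00.tendsto_polLimit F (k + 1) _ θ.ρ8 θ.bV (hl _ (update_mem_window hg i hp) k) μ ν z)
    (Node00.tendsto_polLimit F (k + 1) _ θ.ρ8 θ.bV (hl _ (update_mem_window hg i ht) k) μ ν z)
    (Node00.tendsto_polLimit F (k + 1) _ θ.ρ8 θ.bV (hl _ (update_mem_window hg i hm) k) μ ν z) hW').trans (le_of_eq ?_)
  ring

end Record

end YMDAG.N22.KernelFading

end
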